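import Summits.QuantumFields.YangMills.Theorems.BalabanUVNodesN15KingModelCoverBlockGauge
import Summits.QuantumFields.YangMills.Theorems.BalabanUVNodesN15KingModelRung
import HarnessLib

/-!
# BalabanUVNodes ∕ N15 — THE KING-MODEL RUNG (PART Ͻ-n): FINITE COVERS — KING's TOP-SCALE PIECE `G^η_{(K)} = N^{d+1}(C^η − G(K))` AT A TORON: the toron twin `topPieceTw` of the tree's
# `King1986.Torus.topPiece`, its DESCENT along coverings (image sum), the `U ≡ 1` bridge `topPieceTw 1 = (topPiece)_ℂ`, its character gauge at trivial holonomy, the BASE-POINT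
# SAMPLING `b ↦ L^Kb` as a pair of lifting matrices, and — for two levels reading the same constant field — the EXACT identity of moduli with the g0 rung's real kernel `topPieceStep`
# (Track A, DAG node N15 = NE2; FAN-OUT v1.1 §N15 s3 «KING-MODEL RUNG … NE2's analogue DECIDED in the model … + what the curved case adds»; count-neutral)

HONEST FRAMING.  Count-neutral (cell `pub-ymgap`, seat `pub-ymgap-dag-n15-e` g45; `--supports stmt-QuantumFields-27247 --as helper` = K3ᴬ, KEY MAP v3).  King's `A = 0`
comparison model [King1986] at a constant abelian (flat) link field: the FINE (site) layer object of the g0 rung — King's top-scale piece of the fine covariance, `G^η_{(K)} = C^η −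
a_KG_KQ_K^*(Δ^{(K)})⁻¹Q_KG_K·a_K` ((2.17) p.653, (4.44) p.675; tree `topPiece N M a c m² = N^{d}·((lapF)⁻¹ − (fineOp)⁻¹)`) — with King's `lapF`, `fineOp` replaced by PART Ͷ's
`toronOp`, `fineOpTw`.  Exact finite-dimensional identities; NOT Bałaban's `G_k(U)`; NOT a node discharge (N15 of record untouched); nothing continuum ∕ ℝ⁴ ∕ OS ∕ Clay.

PROVED HERE:
* §1 `topPieceTw` (def), ★★ `topPieceTw_lifts` (every covering, unit `ω`), `topPieceTw_apply_eq_sum_cover`, ★★ **`topPieceTw_one_eq_map_topPiece`** (`U ≡ 1` bridge), ★★★ **`topPieceTw_eq_char_conj`**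
  (`= D_f^*·topPieceTw(1)·D_f` when `χ_p(e_μ) = ω_μ`), ★★★ **`topPieceTw_apply_eq_char_topPiece`** (`= χ̄_p(x)·(topPiece x y : ℂ)·χ_p(y)`);
* §2 BASE-POINT SAMPLING: `basePt_eq_bpt_zero`, `basePt_eq_up`, `proj_basePt`, `basePtMat` (def), `basePtMat_mulVec`, ★ `basePtMat_lifts`, `transpose_basePtMat_mulVec_bpt`, ★ `basePtMat_transpose_lifts`
  (block decomposition on the cover), `sample_apply` (`(P·T·Pᵀ)(b,b′) = T(L^Kb, L^Kb′)`), `topPieceTwBase` (def: g0's `topPieceBase` at a toron, `= P·topPieceTw·Pᵀ`), `topPieceTwBase_apply`, ★★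
  `topPieceTwBase_lifts`, ★★★ **`topPieceTwBase_apply_eq_sum_cover`** (the base-point kernel on `T_M` is the image sum over `T_{M′}`);
* §3 `chi_basePt_eq_prod_pow` (`χ_p(L^Kb) = Π(ω_ν^{L^K})^{val b_ν}`), ★★ `topPieceTwBase_apply_eq_char` (`= χ̄_p(L^Kb)·(topPieceBase b b′ : ℂ)·χ_p(L^Kb′)`), ★★★ **`norm_topPieceTwBase_sub_eq`** (two
  levels `N₁, N₂` on one unit torus, trivial holonomy, same unit-lattice phases `ω₁^{N₁} = ω₂^{N₂}` ⇒ `‖topPieceTwBase₂(ω₂) − topPieceTwBase₁(ω₁)‖(b,b′) = |topPieceBase₂ − topPieceBase₁|(b,b′)`).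
PRIOR TREE ART (by name): Ͻ-a (`Lifts`, `.mul`, `.sub`, `.smul`, `.apply_eq_sum_fiber`, `.norm_apply_le_sum`), Ͻ-b (`proj`, `fineDvd`, `proj_up`, `proj_bpt`, `proj_bpt_eq_iff`, `exists_bpt_eq`,
`bpt_eq_bpt_iff`), Ͻ-c (`toronOp_inv_lifts`), Ͻ-d (`toronOp_inv_eq_char_conj`, `charDiag_mul_conjTranspose`, `exists_char_of_pow_eq_one`), Ͻ-e (`fineOpTw_inv_lifts`), Ͻ-f
(`fineOpTw_inv_eq_char_conj`, `chi_up_eq_prod_pow`), Ͻ-g (`map_ofReal_*`, `fineOpTw_one_eq_map_fineOp`), Ͷ-g (`toronOp_zero_eq_map_lapF`), Ͱ-a (`lapF_det_isUnit`), the g0 rung (`basePt`,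
`topPieceBase`, `blockOf_basePt`), `King1986.Torus` (`topPiece`, `fineOp_isUnit`, `site_eq_bpt`, `corner_eq_up`, `site_eq`), Ε-e (`norm_chi_eq_one`).  Dedup (rg at filing): basename 0
files; needles `topPieceTw|basePtMat|topPieceTwBase|chi_basePt` 0 tree files.  presearch: n/a (composition).  Locators: [King1986] (2.17) p.653, (4.44)–(4.45) p.675, (4.4)–(4.5) p.670;
[Balaban1985BackgroundPropagators] (3.19)–(3.20) p.393, (3.23) p.394, p.398 l.19, Thm 3.2 (3.48) p.398 (the site-layer shape); [Balaban1984PropagatorsI] (1.29) p.23.  0 `sorry`, 3 `def`.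
-/

noncomputable section

open scoped BigOperators ComplexConjugate ComplexOrder
open Finset Matrix

namespace Summit.QuantumFields.YangMills.BalabanUVNodes.N15KingModelRung.Cover

open Literature.MathematicalPhysics.QuantumFieldTheory.Balaban1983to89.B5Prop11Plancherel (Tor unitVec fine chi)
open Literature.MathematicalPhysics.QuantumFieldTheory.Balaban1983to89.B5Block118 (bpt up iota)
open Literature.MathematicalPhysics.QuantumFieldTheory.Balaban1983to89.B5ToronMomentum161 (twistOf twistOf_zero)
open Literature.MathematicalPhysics.QuantumFieldTheory.King1986 (aK)
open Literature.MathematicalPhysics.QuantumFieldTheory.King1986.Torus (lapF topPiece fineOp fineOp_isUnit site site_eq_bpt site_eq corner_eq_up)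
open Summit.QuantumFields.YangMills.BalabanUVNodes.N15KingModelRung (basePt topPieceBase)
open Summit.QuantumFields.YangMills.BalabanUVNodes.N15KingModelRung.Toron (toronOp toronOp_posDef fineOpTw isUnit_fineOpTw toronOp_zero_eq_map_lapF)
open Summit.QuantumFields.YangMills.BalabanUVNodes.N15KingModelRung.Covariant (lapF_det_isUnit)
open Summit.QuantumFields.YangMills.BalabanUVNodes.N15KingModelRung.TorusSpectral (norm_chi_eq_one)

variable {d : ℕ} (N : ℕ) [NeZero N] (M : Fin (d + 1) → ℕ) [hM : ∀ μ, NeZero (M μ)]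

/-! ## §1 The toron top piece: descent, bridge, character gauge -/

/-- KING's TOP-SCALE PIECE AT THE TORON: `G^η_{(K)}(ω) := N^{d+1}·((−cΔ_ω + m²)⁻¹ − A₀(ω)⁻¹)` — the tree's `topPiece` with `lapF ↦ toronOp`, `fineOp ↦ fineOpTw`.
[cite: King1986, (2.17) p.653, (4.44) p.675] -/
def topPieceTw (a c m2 : ℝ) (ω : Fin (d + 1) → ℂ) : Matrix (Tor (fine N M)) (Tor (fine N M)) ℂ :=
  ((N : ℂ) ^ (d + 1)) • ((toronOp (fine N M) c m2 ω)⁻¹ - (fineOpTw N M a c m2 ω)⁻¹)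

variable {M} {M' : Fin (d + 1) → ℕ} [hM' : ∀ μ, NeZero (M' μ)]

/-- ★★ **THE TORON TOP PIECE DESCENDS** along every covering of the fine tori (unit `ω`, `a, c ≥ 0`, `m² > 0`). [cite: King1986, (4.44) p.675] -/
theorem topPieceTw_lifts (h : ∀ μ, M μ ∣ M' μ) {a c m2 : ℝ} (ha : 0 ≤ a) (hc : 0 ≤ c) (hm : 0 < m2) {ω : Fin (d + 1) → ℂ} (hω : ∀ μ, ‖ω μ‖ = 1) :
    Lifts (proj (fineDvd N h)) (proj (fineDvd N h)) (topPieceTw N M' a c m2 ω) (topPieceTw N M a c m2 ω) := by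
  unfold topPieceTw
  exact ((toronOp_inv_lifts (fineDvd N h) hc hm hω).sub (fineOpTw_inv_lifts N h ha hc hm hω)).smul _

/-- The image sum for the toron top piece. [cite: King1986, (4.44) p.675] -/
theorem topPieceTw_apply_eq_sum_cover (h : ∀ μ, M μ ∣ M' μ) {a c m2 : ℝ} (ha : 0 ≤ a) (hc : 0 ≤ c) (hm : 0 < m2) {ω : Fin (d + 1) → ℂ} (hω : ∀ μ, ‖ω μ‖ = 1)
    (x' : Tor (fine N M')) (y : Tor (fine N M)) :
    topPieceTw N M a c m2 ω (proj (fineDvd N h) x') y = ∑ y' ∈ fiber (proj (fineDvd N h)) y, topPieceTw N M' a c m2 ω x' y' :=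
  (topPieceTw_lifts N h ha hc hm hω).apply_eq_sum_fiber x' y

variable (M)

/-- ★★ **THE `U ≡ 1` BRIDGE**: `topPieceTw N M a c m² 1 = (King1986.Torus.topPiece N M a c m²)_ℂ` (`a, c ≥ 0`, `m² > 0`). [cite: King1986, (4.44) p.675] -/
theorem topPieceTw_one_eq_map_topPiece {a c m2 : ℝ} (ha : 0 ≤ a) (hc : 0 ≤ c) (hm : 0 < m2) :
    topPieceTw N M a c m2 (1 : Fin (d + 1) → ℂ) = (topPiece N M a c m2).map ((↑) : ℝ → ℂ) := by
  have hu1 : IsUnit (lapF (fine N M) c m2).det := lapF_det_isUnit (fine N M) hc hm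
  have hu2 : IsUnit (fineOp N M a c m2).det := (Matrix.isUnit_iff_isUnit_det _).mp (fineOp_isUnit N M ha hc hm)
  rw [topPieceTw, ← twistOf_zero, toronOp_zero_eq_map_lapF, twistOf_zero, fineOpTw_one_eq_map_fineOp, ← map_ofReal_inv _ hu1, ← map_ofReal_inv _ hu2, ← map_ofReal_sub, topPiece,
    map_ofReal_smul]
  push_cast; rfl

/-- ★★★ **THE TORON TOP PIECE IS THE FINE CHARACTER GAUGE OF ITS `ω ≡ 1` VERSION**: `topPieceTw ω = D_f^*·topPieceTw(1)·D_f` whenever `χ_p(e_μ) = ω_μ` (`a, c ≥ 0`, `m² > 0`).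
[cite: King1986, (4.44) p.675; Balaban1985BackgroundPropagators, p.398 l.19] -/
theorem topPieceTw_eq_char_conj {a c m2 : ℝ} (ha : 0 ≤ a) (hc : 0 ≤ c) (hm : 0 < m2) {p : Tor (fine N M)} {ω : Fin (d + 1) → ℂ}
    (hp : ∀ μ, chi (fine N M) p (unitVec (fine N M) μ) = ω μ) :
    topPieceTw N M a c m2 ω = (diagonal (chi (fine N M) p))ᴴ * topPieceTw N M a c m2 (1 : Fin (d + 1) → ℂ) * diagonal (chi (fine N M) p) := by
  rw [topPieceTw, topPieceTw, toronOp_inv_eq_char_conj (fine N M) hc hm hp, fineOpTw_inv_eq_char_conj N M ha hc hm hp, ← Matrix.sub_mul, ← Matrix.mul_sub]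
  simp only [Matrix.smul_mul, Matrix.mul_smul]

/-- ★★★ **ENTRYWISE**: `topPieceTw ω (x,y) = χ̄_p(x)·(topPiece x y : ℂ)·χ_p(y)`. [cite: King1986, (4.44) p.675; Balaban1985BackgroundPropagators, p.398 l.19] -/
theorem topPieceTw_apply_eq_char_topPiece {a c m2 : ℝ} (ha : 0 ≤ a) (hc : 0 ≤ c) (hm : 0 < m2) {p : Tor (fine N M)} {ω : Fin (d + 1) → ℂ}
    (hp : ∀ μ, chi (fine N M) p (unitVec (fine N M) μ) = ω μ) (x y : Tor (fine N M)) :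
    topPieceTw N M a c m2 ω x y = conj (chi (fine N M) p x) * (((topPiece N M a c m2 x y : ℝ)) : ℂ) * chi (fine N M) p y := by
  rw [topPieceTw_eq_char_conj N M ha hc hm hp, topPieceTw_one_eq_map_topPiece N M ha hc hm, Matrix.mul_apply]
  simp only [Matrix.diagonal_conjTranspose, Matrix.diagonal_mul, Pi.star_apply, Complex.star_def, Matrix.map_apply]
  rw [Finset.sum_eq_single y (fun z _ hz => by rw [Matrix.diagonal_apply_ne _ hz, mul_zero]) (fun h => absurd (Finset.mem_univ y) h), Matrix.diagonal_apply_eq]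

/-! ## §2 Base-point sampling `b ↦ L^K b` as lifting matrices -/

/-- The base point is the block point with offset `0`. [folklore] -/
theorem basePt_eq_bpt_zero (b : Tor M) : basePt N M b = bpt N M b (fun _ => ⟨0, Nat.pos_of_ne_zero (NeZero.ne N)⟩) := by
  rw [basePt, site_eq_bpt]

/-- The base point is B5's `up` (`= Nb`). [folklore] -/
theorem basePt_eq_up (b : Tor M) : basePt N M b = up N M b := by
  rw [basePt, site_eq, corner_eq_up]
  have : iota N M (fun _ : Fin (d + 1) => (⟨0, Nat.pos_of_ne_zero (NeZero.ne N)⟩ : Fin N)) = 0 := by funext ν; simp [iota]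
  rw [this, add_zero]

variable {M}

/-- Base points project to base points. [folklore] -/
theorem proj_basePt (h : ∀ μ, M μ ∣ M' μ) (b : Tor M') : proj (fineDvd N h) (basePt N M' b) = basePt N M (proj h b) := by
  rw [basePt_eq_up, basePt_eq_up, proj_up]

variable (M)

/-- THE BASE-POINT SAMPLING MATRIX `P(b, x) = [x = L^Kb]` (unit torus ← fine torus). [cite: King1986, (2.17) p.653 (unit-lattice fields read at block base points)] -/
def basePtMat : Matrix (Tor M) (Tor (fine N M)) ℂ := fun b x => if x = basePt N M b then 1 else 0

/-- `(Pf)(b) = f(L^Kb)`. [folklore] -/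
theorem basePtMat_mulVec (f : Tor (fine N M) → ℂ) (b : Tor M) : (basePtMat N M *ᵥ f) b = f (basePt N M b) := by
  simp only [Matrix.mulVec, dotProduct, basePtMat, ite_mul, one_mul, zero_mul]
  rw [Finset.sum_ite_eq' Finset.univ (basePt N M b), if_pos (Finset.mem_univ _)]

/-- `(Pᵀg)(Nc + j) = [j = 0]·g(c)`. [folklore] -/
theorem transpose_basePtMat_mulVec_bpt (g : Tor M → ℂ) (c : Tor M) (j : Fin (d + 1) → Fin N) :
    ((basePtMat N M)ᵀ *ᵥ g) (bpt N M c j) = if j = (fun _ => ⟨0, Nat.pos_of_ne_zero (NeZero.ne N)⟩) then g c else 0 := by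
  simp only [Matrix.mulVec, dotProduct, Matrix.transpose_apply, basePtMat, basePt_eq_bpt_zero]
  have hiff : ∀ b : Tor M, (bpt N M c j = bpt N M b (fun _ => ⟨0, Nat.pos_of_ne_zero (NeZero.ne N)⟩)) ↔ (b = c ∧ j = (fun _ => ⟨0, Nat.pos_of_ne_zero (NeZero.ne N)⟩)) :=
    fun b => by rw [bpt_eq_bpt_iff N c b]; constructor <;> rintro ⟨h1, h2⟩ <;> exact ⟨h1.symm, h2⟩
  simp_rw [hiff]
  by_cases hj : j = (fun _ => ⟨0, Nat.pos_of_ne_zero (NeZero.ne N)⟩)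
  · simp only [hj, and_true, if_true, ite_mul, one_mul, zero_mul]
    rw [Finset.sum_ite_eq' Finset.univ c, if_pos (Finset.mem_univ _)]
  · simp only [hj, and_false, if_false, zero_mul, Finset.sum_const_zero]

variable {M}

/-- ★ THE SAMPLING MATRIX DESCENDS (output: unit lattice; input: fine lattice). [folklore] -/
theorem basePtMat_lifts (h : ∀ μ, M μ ∣ M' μ) : Lifts (proj h) (proj (fineDvd N h)) (basePtMat N M') (basePtMat N M) := by
  intro f; funext b
  change (basePtMat N M' *ᵥ (f ∘ proj (fineDvd N h))) b = (basePtMat N M *ᵥ f) (proj h b)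
  rw [basePtMat_mulVec, basePtMat_mulVec, Function.comp_apply, proj_basePt]

/-- ★ ITS TRANSPOSE DESCENDS (output: fine lattice; input: unit lattice) — block decomposition on the cover. [folklore] -/
theorem basePtMat_transpose_lifts (h : ∀ μ, M μ ∣ M' μ) : Lifts (proj (fineDvd N h)) (proj h) (basePtMat N M')ᵀ (basePtMat N M)ᵀ := by
  intro g; funext x
  obtain ⟨c, j, rfl⟩ := exists_bpt_eq N (M := M') x
  change ((basePtMat N M')ᵀ *ᵥ (g ∘ proj h)) (bpt N M' c j) = ((basePtMat N M)ᵀ *ᵥ g) (proj (fineDvd N h) (bpt N M' c j))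
  rw [transpose_basePtMat_mulVec_bpt, proj_bpt N h, transpose_basePtMat_mulVec_bpt]
  rfl

variable (M)

/-- `(P·T·Pᵀ)(b,b′) = T(L^Kb, L^Kb′)`. [folklore] -/
theorem sample_apply (T : Matrix (Tor (fine N M)) (Tor (fine N M)) ℂ) (b b' : Tor M) :
    (basePtMat N M * T * (basePtMat N M)ᵀ) b b' = T (basePt N M b) (basePt N M b') := by
  rw [Matrix.mul_assoc, Matrix.mul_apply]
  simp only [basePtMat, ite_mul, one_mul, zero_mul]
  rw [Finset.sum_ite_eq' Finset.univ (basePt N M b), if_pos (Finset.mem_univ _), Matrix.mul_apply]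
  simp only [Matrix.transpose_apply, basePtMat, mul_ite, mul_one, mul_zero]
  rw [Finset.sum_ite_eq' Finset.univ (basePt N M b'), if_pos (Finset.mem_univ _)]

/-- THE TORON TOP PIECE AT BASE POINTS (g0's `topPieceBase` with the toron): `P·topPieceTw·Pᵀ`, constants `a_K = aK a L K`, `c = N²`. [cite: King1986, (2.17) p.653, (4.44) p.675] -/
def topPieceTwBase (L : ℕ) (a m2 : ℝ) (K : ℕ) (ω : Fin (d + 1) → ℂ) : Matrix (Tor M) (Tor M) ℂ :=
  basePtMat N M * topPieceTw N M (aK a L K) (((N : ℕ) : ℝ) ^ 2) m2 ω * (basePtMat N M)ᵀ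

/-- Entries: `topPieceTwBase(b,b′) = topPieceTw(L^Kb, L^Kb′)`. [cite: King1986, (4.44) p.675] -/
theorem topPieceTwBase_apply (L : ℕ) (a m2 : ℝ) (K : ℕ) (ω : Fin (d + 1) → ℂ) (b b' : Tor M) :
    topPieceTwBase N M L a m2 K ω b b' = topPieceTw N M (aK a L K) (((N : ℕ) : ℝ) ^ 2) m2 ω (basePt N M b) (basePt N M b') :=
  sample_apply N M _ b b'

variable {M}

/-- ★★ THE BASE-POINT KERNEL DESCENDS (coarse projection on both sides; unit `ω`, `a ≥ 0`, `m² > 0`). [cite: King1986, (4.44) p.675] -/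
theorem topPieceTwBase_lifts (h : ∀ μ, M μ ∣ M' μ) (L : ℕ) {a m2 : ℝ} (K : ℕ) (ha : 0 ≤ aK a L K) (hm : 0 < m2) {ω : Fin (d + 1) → ℂ} (hω : ∀ μ, ‖ω μ‖ = 1) :
    Lifts (proj h) (proj h) (topPieceTwBase N M' L a m2 K ω) (topPieceTwBase N M L a m2 K ω) := by
  unfold topPieceTwBase
  exact ((basePtMat_lifts N h).mul (topPieceTw_lifts N h ha (sq_nonneg _) hm hω)).mul (basePtMat_transpose_lifts N h)

/-- ★★★ **THE BASE-POINT TOP-PIECE KERNEL ON `T_M` IS THE IMAGE SUM OVER `T_{M′}`**: `topPieceTwBase_M(π b̃, b′) = Σ_{b̃′ : π b̃′ = b′} topPieceTwBase_{M′}(b̃, b̃′)`. [cite: King1986, (4.44) p.675] -/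
theorem topPieceTwBase_apply_eq_sum_cover (h : ∀ μ, M μ ∣ M' μ) (L : ℕ) {a m2 : ℝ} (K : ℕ) (ha : 0 ≤ aK a L K) (hm : 0 < m2) {ω : Fin (d + 1) → ℂ}
    (hω : ∀ μ, ‖ω μ‖ = 1) (b' : Tor M') (b : Tor M) :
    topPieceTwBase N M L a m2 K ω (proj h b') b = ∑ b'' ∈ fiber (proj h) b, topPieceTwBase N M' L a m2 K ω b' b'' :=
  (topPieceTwBase_lifts N h L K ha hm hω).apply_eq_sum_fiber b' b

/-- ★ Differences of two levels descend with fibrewise majorants. [cite: King1986, (4.45) p.675] -/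
theorem norm_topPieceTwBase_sub_apply_le_of_cover (N₁ N₂ : ℕ) [NeZero N₁] [NeZero N₂] (h : ∀ μ, M μ ∣ M' μ) (L : ℕ) {a m2 : ℝ} (K₁ K₂ : ℕ)
    (ha₁ : 0 ≤ aK a L K₁) (ha₂ : 0 ≤ aK a L K₂) (hm : 0 < m2) {ω₁ ω₂ : Fin (d + 1) → ℂ} (hω₁ : ∀ μ, ‖ω₁ μ‖ = 1) (hω₂ : ∀ μ, ‖ω₂ μ‖ = 1)
    {F : Tor M' → Tor M' → ℝ} (hF : ∀ b' b'', ‖topPieceTwBase N₂ M' L a m2 K₂ ω₂ b' b'' - topPieceTwBase N₁ M' L a m2 K₁ ω₁ b' b''‖ ≤ F b' b'') (b' : Tor M') (b : Tor M) :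
    ‖topPieceTwBase N₂ M L a m2 K₂ ω₂ (proj h b') b - topPieceTwBase N₁ M L a m2 K₁ ω₁ (proj h b') b‖ ≤ ∑ b'' ∈ fiber (proj h) b, F b' b'' := by
  have hl := (topPieceTwBase_lifts N₂ h L K₂ ha₂ hm hω₂).sub (topPieceTwBase_lifts N₁ h L K₁ ha₁ hm hω₁)
  have := hl.norm_apply_le_sum (F := F) (fun b' b'' => by simpa only [Matrix.sub_apply] using hF b' b'') b' b
  simpa only [Matrix.sub_apply] using this

/-! ## §3 Trivial holonomy: the base-point kernels have the g0 rung's real moduli -/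

variable (M)

/-- The character at a base point depends only on the unit-lattice phases: `χ_p(L^Kb) = Π_ν(χ_p(e_ν)^N)^{val b_ν}`. [cite: Balaban1985BackgroundPropagators, (3.19) p.393] -/
theorem chi_basePt_eq_prod_pow (p : Tor (fine N M)) (b : Tor M) :
    chi (fine N M) p (basePt N M b) = ∏ ν, (chi (fine N M) p (unitVec (fine N M) ν) ^ N) ^ (b ν).val := by
  rw [basePt_eq_up, chi_up_eq_prod_pow]

/-- ★★ `topPieceTwBase(ω)(b,b′) = χ̄_p(L^Kb)·(topPieceBase b b′ : ℂ)·χ_p(L^Kb′)` at trivial holonomy (`a_K ≥ 0`, `m² > 0`). [cite: King1986, (4.44) p.675; Balaban1985BackgroundPropagators, p.398 l.19] -/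
theorem topPieceTwBase_apply_eq_char (L : ℕ) [NeZero L] {a m2 : ℝ} (K : ℕ) (ha : 0 ≤ aK a L K) (hm : 0 < m2) {p : Tor (fine N M)} {ω : Fin (d + 1) → ℂ}
    (hp : ∀ μ, chi (fine N M) p (unitVec (fine N M) μ) = ω μ) (b b' : Tor M) :
    topPieceTwBase N M L a m2 K ω b b' = conj (chi (fine N M) p (basePt N M b)) * ((topPieceBase L N M a m2 K b b' : ℝ) : ℂ) * chi (fine N M) p (basePt N M b') := by
  rw [topPieceTwBase_apply, topPieceTw_apply_eq_char_topPiece N M ha (sq_nonneg _) hm hp]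
  rfl

/-- ★★★ **TWO LEVELS, SAME CONSTANT FIELD ⇒ THE DIFFERENCE HAS THE g0 RUNG's REAL MODULUS EXACTLY**: on one unit torus with fine levels `N₁, N₂`, trivial holonomy at both levels and
equal unit-lattice phases `χ_{p₁}(e)^{N₁} = χ_{p₂}(e)^{N₂}`: `‖topPieceTwBase₂(ω₂)(b,b′) − topPieceTwBase₁(ω₁)(b,b′)‖ = |topPieceBase₂(b,b′) − topPieceBase₁(b,b′)|`.
[cite: King1986, (4.45) p.675, Prop. 3.9 (3.73) p.665] -/
theorem norm_topPieceTwBase_sub_eq (N₁ N₂ : ℕ) [NeZero N₁] [NeZero N₂] (L : ℕ) [NeZero L] {a m2 : ℝ} (K₁ K₂ : ℕ) (ha₁ : 0 ≤ aK a L K₁) (ha₂ : 0 ≤ aK a L K₂) (hm : 0 < m2)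
    {p₁ : Tor (fine N₁ M)} {p₂ : Tor (fine N₂ M)} {ω₁ ω₂ : Fin (d + 1) → ℂ}
    (hp₁ : ∀ μ, chi (fine N₁ M) p₁ (unitVec (fine N₁ M) μ) = ω₁ μ) (hp₂ : ∀ μ, chi (fine N₂ M) p₂ (unitVec (fine N₂ M) μ) = ω₂ μ)
    (hθ : ∀ μ, chi (fine N₁ M) p₁ (unitVec (fine N₁ M) μ) ^ N₁ = chi (fine N₂ M) p₂ (unitVec (fine N₂ M) μ) ^ N₂) (b b' : Tor M) :
    ‖topPieceTwBase N₂ M L a m2 K₂ ω₂ b b' - topPieceTwBase N₁ M L a m2 K₁ ω₁ b b'‖ = |topPieceBase L N₂ M a m2 K₂ b b' - topPieceBase L N₁ M a m2 K₁ b b'| := by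
  have hbp : ∀ c : Tor M, chi (fine N₁ M) p₁ (basePt N₁ M c) = chi (fine N₂ M) p₂ (basePt N₂ M c) := fun c => by
    rw [chi_basePt_eq_prod_pow, chi_basePt_eq_prod_pow]; simp only [hθ]
  rw [topPieceTwBase_apply_eq_char N₂ M L K₂ ha₂ hm hp₂, topPieceTwBase_apply_eq_char N₁ M L K₁ ha₁ hm hp₁, hbp b, hbp b', ← sub_mul, ← mul_sub, ← Complex.ofReal_sub,
    norm_mul, norm_mul, Complex.norm_conj, norm_chi_eq_one, norm_chi_eq_one, one_mul, mul_one, Complex.norm_real, Real.norm_eq_abs]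

end Summit.QuantumFields.YangMills.BalabanUVNodes.N15KingModelRung.Cover

end
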